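import Literature.AlgebraicGeometry.Morphisms.CechUnitCocycleDifferenceClass
import HarnessLib

/-!
# The Kodaira–Spencer cocycle of a family of transition functions

`DerAt ev` (derivations `B → A` at an augmentation = tangent vectors), `tD`, `ksCochain p ev D` — for transition data
`p ∈ UCocycle f U B` with values in a chart ring `B`: the KODAIRA–SPENCER COCHAIN `p̄_{ij}⁻¹ · (1 ⊗ D)(p_{ij})`; the
coordinates `liftDiffCoord` of `φ'' − φ'` for two lifts `φ', φ'' : B → R` of one point are derivations
(`liftDiffCoord_mem_derAt`); MAIN IDENTITY `diffCochain_map_map` / `diffClass_map_map`: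
`diffCochain (p.map φ') (p.map φ'') = (ksCochain p (ρ ∘ φ') (liftDiffCoord ℓ))_ℓ` ([GortzWedhorn2023] Prop. 27.122, proof;
[MumfordAV1970] §13, proof of the Theorem p. 125: «the obstruction to modifying the lift is a class in `H¹(𝒪)`»).
HC_CM is proved only modulo the 7 printed citations until rung 0 closes.

## References
* [GortzWedhorn2023] U. Görtz, T. Wedhorn, *Algebraic Geometry II*, Lemma 26.15, Prop. 27.122 (`Lie(Pic_{X/S}) ≅ R¹f_*𝒪_X` via `U[ε]`).
* [MumfordAV1970] D. Mumford, *Abelian Varieties*, §13 (proof of the Thm. pp. 125–130).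
* The Stacks Project, Tag 08SP (deformations of invertible modules), Tag 01ED (Čech cohomology).
-/

noncomputable section

universe u v

open TensorProduct CategoryTheory AlgebraicGeometry
open Literature.RingTheory.Flat Literature.RingTheory.Flat.IsSmallExtension

namespace Literature.AlgebraicGeometry.Morphisms

namespace CechUnitCocycle

variable {A : Type u} [CommRing A] {X : Scheme.{u}} (f : X ⟶ Spec (.of A)) {ι : Type v} (U : ι → X.Opens)

/-! ## §5 The Kodaira–Spencer cocycle of a family of transition functions -/

section KS

variable {f} {U}
variable {B : Type u} [CommRing B] [Algebra A B]

/-- **`A`-derivations of `B` into `A` at an augmentation `ev : B → A`** (tangent vectors at the point `ev`):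
`D(bb') = ev(b) D(b') + ev(b') D(b)`, as a submodule of `B →ₗ[A] A`. [folklore] -/
def DerAt (ev : B →ₐ[A] A) : Submodule A (B →ₗ[A] A) where
  carrier := {D | ∀ b b', D (b * b') = ev b * D b' + ev b' * D b}
  add_mem' {D D'} hD hD' b b' := by
    simp only [LinearMap.add_apply, hD b b', hD' b b']; ring
  zero_mem' b b' := by simp
  smul_mem' a D hD b b' := by
    simp only [LinearMap.smul_apply, hD b b', smul_eq_mul]; ring

/-- Membership in `DerAt`. [cite: GortzWedhorn2023, Prop. 27.122 (proof)] -/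
theorem mem_derAt_iff (ev : B →ₐ[A] A) (D : B →ₗ[A] A) :
    D ∈ DerAt ev ↔ ∀ b b', D (b * b') = ev b * D b' + ev b' * D b := Iff.rfl

variable (f) in
/-- `(1 ⊗ D)(x)` read in `Γ(V)`: `s ⊗ b ↦ D(b) · s`. [folklore] -/
def tD (V : X.Opens) (D : B →ₗ[A] A) : Sections f V ⊗[A] B →ₗ[A] Sections f V :=
  (TensorProduct.rid A (Sections f V)).toLinearMap ∘ₗ LinearMap.lTensor (Sections f V) D

/-- `tD` on pure tensors. [cite: GortzWedhorn2023, Prop. 27.122 (proof)] -/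
@[simp] theorem tD_tmul (V : X.Opens) (D : B →ₗ[A] A) (s : Sections f V) (b : B) : tD f V D (s ⊗ₜ b) = D b • s := by
  simp [tD, TensorProduct.rid_tmul]

/-- `tD` is additive in `D`. [cite: GortzWedhorn2023, Prop. 27.122 (proof)] -/
theorem tD_add (V : X.Opens) (D D' : B →ₗ[A] A) (x : Sections f V ⊗[A] B) :
    tD f V (D + D') x = tD f V D x + tD f V D' x := by
  simp [tD, LinearMap.lTensor_add]

/-- `tD` is homogeneous in `D`. [cite: GortzWedhorn2023, Prop. 27.122 (proof)] -/
theorem tD_smul (V : X.Opens) (a : A) (D : B →ₗ[A] A) (x : Sections f V ⊗[A] B) :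
    tD f V (a • D) x = a • tD f V D x := by
  simp [tD, LinearMap.lTensor_smul]

/-- `tD` commutes with restriction. [cite: GortzWedhorn2023, Prop. 27.122 (proof)] -/
theorem res_tD {V W : X.Opens} (h : W ≤ V) (D : B →ₗ[A] A) (x : Sections f V ⊗[A] B) :
    Sections.res f h (tD f V D x) = tD f W D (resR f B h x) := by
  induction x using TensorProduct.induction_on with
  | zero => simp
  | tmul s b => simp
  | add x y hx hy => simp only [map_add, hx, hy]

/-- The reduction `p̄_{ij} = (1 ⊗ ev)(p_{ij}) ∈ Γ(U_{ij})` of transition data along the augmentation, a unit.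
[cite: GortzWedhorn2023, Prop. 27.122 (proof)] -/
theorem isUnit_red (p : UCocycle f U B) (ev : B →ₐ[A] A) (i j : ι) : IsUnit (red f ev _ (p.val i j)) :=
  (p.isUnit i j).map _

/-- **The Kodaira–Spencer cochain** of transition data `p` along a tangent vector `D` at `ev`:
`KS(D)_{ij} := p̄_{ij}⁻¹ · (1 ⊗ D)(p_{ij})` («`d log p` along `D`»).
[cite: GortzWedhorn2023, Prop. 27.122 (proof, `U[ε]`)] -/
def ksCochain (p : UCocycle f U B) (ev : B →ₐ[A] A) (D : B →ₗ[A] A) : CechC1 f U :=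
  fun i j => ↑(isUnit_red p ev i j).unit⁻¹ * tD f _ D (p.val i j)

/-- Defining property: `p̄_{ij} · KS(D)_{ij} = (1 ⊗ D)(p_{ij})`. [cite: GortzWedhorn2023, Prop. 27.122 (proof)] -/
theorem red_mul_ksCochain (p : UCocycle f U B) (ev : B →ₐ[A] A) (D : B →ₗ[A] A) (i j : ι) :
    red f ev _ (p.val i j) * ksCochain p ev D i j = tD f _ D (p.val i j) := by
  rw [ksCochain, ← mul_assoc, IsUnit.mul_val_inv, one_mul]

/-- `KS` is additive in `D`. [cite: GortzWedhorn2023, Prop. 27.122 (proof)] -/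
theorem ksCochain_add (p : UCocycle f U B) (ev : B →ₐ[A] A) (D D' : B →ₗ[A] A) :
    ksCochain p ev (D + D') = ksCochain p ev D + ksCochain p ev D' := by
  funext i j
  simp only [ksCochain, Pi.add_apply, tD_add, mul_add]

/-- `KS` is `A`-homogeneous in `D`. [cite: GortzWedhorn2023, Prop. 27.122 (proof)] -/
theorem ksCochain_smul (p : UCocycle f U B) (ev : B →ₐ[A] A) (a : A) (D : B →ₗ[A] A) :
    ksCochain p ev (a • D) = a • ksCochain p ev D := by
  funext i j
  simp only [ksCochain, Pi.smul_apply, tD_smul, Algebra.mul_smul_comm]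

/-! ### The main identity: the difference cochain of two lifts of a point is the KS cochain of their difference -/

variable {R R₀ : Type u} [CommRing R] [CommRing R₀] [Algebra A R] [Algebra A R₀]
  {π : R →ₐ[A] R₀} {ρ : R →ₐ[A] A} {I : Ideal R} {d : ℕ} {e : (Fin d → A) ≃ₗ[A] I}
  (H : IsSmallExtension π ρ I e) {ρ₀ : R₀ →ₐ[A] A} (hρ : ρ₀.comp π = ρ)

include H

/-- The difference `φ'' − φ'` of two lifts lands in `I = ker π`. [cite: GortzWedhorn2023, Prop. 27.122 (proof)] -/
theorem sub_mem_of_comp_eq (φ' φ'' : B →ₐ[A] R) (hφ : π.comp φ'' = π.comp φ') (b : B) : φ'' b - φ' b ∈ I := by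
  rw [← H.mem_ker_π, map_sub]
  have := congrArg (fun ψ : B →ₐ[A] R₀ => ψ b) hφ
  simp only [AlgHom.comp_apply] at this
  rw [this, sub_self]

/-- **The coordinates of `φ'' − φ'`** in the frame `e : A^d ≅ I`: `A`-linear maps `B → A`. [folklore] -/
def liftDiffCoord (φ' φ'' : B →ₐ[A] R) (hφ : π.comp φ'' = π.comp φ') (ℓ : Fin d) : B →ₗ[A] A :=
  (LinearMap.proj ℓ : (Fin d → A) →ₗ[A] A) ∘ₗ e.symm.toLinearMap ∘ₗ
    LinearMap.codRestrict (I.restrictScalars A) (φ''.toLinearMap - φ'.toLinearMap)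
      (fun b => sub_mem_of_comp_eq H φ' φ'' hφ b)

/-- Unfolding of the coordinates. [cite: GortzWedhorn2023, Prop. 27.122 (proof)] -/
theorem liftDiffCoord_apply (φ' φ'' : B →ₐ[A] R) (hφ : π.comp φ'' = π.comp φ') (ℓ : Fin d) (b : B) :
    liftDiffCoord H φ' φ'' hφ ℓ b = e.symm ⟨φ'' b - φ' b, sub_mem_of_comp_eq H φ' φ'' hφ b⟩ ℓ := rfl

/-- Defining property of the coordinates: `φ'' b = φ' b + e(coord(b))`. [cite: GortzWedhorn2023, Prop. 27.122 (proof)] -/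
theorem liftDiffCoord_spec (φ' φ'' : B →ₐ[A] R) (hφ : π.comp φ'' = π.comp φ') (b : B) :
    (e (fun ℓ => liftDiffCoord H φ' φ'' hφ ℓ b) : R) = φ'' b - φ' b := by
  have : (fun ℓ => liftDiffCoord H φ' φ'' hφ ℓ b) =
      e.symm ⟨φ'' b - φ' b, sub_mem_of_comp_eq H φ' φ'' hφ b⟩ := by
    funext ℓ; rfl
  rw [this, LinearEquiv.apply_symm_apply]

include hρ in
/-- `I · I = 0`: `r · e(v) = 0` for `r ∈ I`. [cite: GortzWedhorn2023, Prop. 27.122 (proof)] -/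
theorem mul_e_eq_zero_of_mem {r : R} (hr : r ∈ I) (v : Fin d → A) : r * (e v : R) = 0 := by
  rw [← H.smul_e r v]
  have hρr : ρ r = 0 := by
    rw [← hρ, AlgHom.comp_apply, (H.mem_ker_π r).2 hr, map_zero]
  have : (fun ℓ => ρ r * v ℓ) = 0 := by funext ℓ; simp [hρr]
  rw [this, map_zero]; rfl

include hρ in
/-- **The coordinates of `φ'' − φ'` are derivations at `ev = ρ ∘ φ'`.** [cite: GortzWedhorn2023, Prop. 27.122 (proof)] -/
theorem liftDiffCoord_mem_derAt (φ' φ'' : B →ₐ[A] R) (hφ : π.comp φ'' = π.comp φ') (ℓ : Fin d) :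
    liftDiffCoord H φ' φ'' hφ ℓ ∈ DerAt (ρ.comp φ') := by
  intro b b'
  -- `θ(bb') = φ'(b) θ(b') + φ'(b') θ(b)` with `θ(b) θ(b') = 0`
  set θ : Fin d → B →ₗ[A] A := liftDiffCoord H φ' φ'' hφ
  have hθ : ∀ c, (e (fun ℓ => θ ℓ c) : R) = φ'' c - φ' c := liftDiffCoord_spec H φ' φ'' hφ
  have key : (e (fun ℓ => θ ℓ (b * b')) : R) = (e (fun ℓ => (ρ.comp φ') b * θ ℓ b' + (ρ.comp φ') b' * θ ℓ b) : R) := by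
    rw [hθ, map_mul, map_mul]
    have h1 : φ'' b = φ' b + (e (fun ℓ => θ ℓ b) : R) := by rw [hθ]; ring
    have h2 : φ'' b' = φ' b' + (e (fun ℓ => θ ℓ b') : R) := by rw [hθ]; ring
    have hII : (e (fun ℓ => θ ℓ b) : R) * (e (fun ℓ => θ ℓ b') : R) = 0 :=
      mul_e_eq_zero_of_mem H hρ (e _).2 _
    rw [h1, h2]
    have hadd : (fun ℓ => (ρ.comp φ') b * θ ℓ b' + (ρ.comp φ') b' * θ ℓ b) =
        (fun ℓ => ρ (φ' b) * θ ℓ b') + (fun ℓ => ρ (φ' b') * θ ℓ b) := by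
      funext ℓ; simp
    rw [hadd, map_add, Submodule.coe_add, H.smul_e, H.smul_e]
    calc (φ' b + ↑(e fun ℓ => θ ℓ b)) * (φ' b' + ↑(e fun ℓ => θ ℓ b')) - φ' b * φ' b'
        = φ' b * ↑(e fun ℓ => θ ℓ b') + φ' b' * ↑(e fun ℓ => θ ℓ b) +
          ↑(e fun ℓ => θ ℓ b) * ↑(e fun ℓ => θ ℓ b') := by ring
      _ = φ' b * ↑(e fun ℓ => θ ℓ b') + φ' b' * ↑(e fun ℓ => θ ℓ b) := by rw [hII, add_zero]
  have := congrArg (fun r : I => (e.symm r) ℓ) (Subtype.ext key)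
  simpa using this

omit H in
/-- `coef φ` is `1 ⊗ φ` on underlying linear maps. [cite: GortzWedhorn2023, Prop. 27.122 (proof)] -/
theorem coef_eq_lTensor (φ : B →ₐ[A] R) (V : X.Opens) (x : Sections f V ⊗[A] B) :
    coef f φ V x = LinearMap.lTensor (Sections f V) φ.toLinearMap x := by
  induction x using TensorProduct.induction_on with
  | zero => simp
  | tmul s b => simp
  | add x y hx hy => simp only [map_add, hx, hy]

/-- **`(1 ⊗ φ'')(x) = (1 ⊗ φ')(x) + κ((1 ⊗ θ_ℓ)(x))_ℓ`.** [cite: GortzWedhorn2023, Prop. 27.122 (proof)] -/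
theorem coef_eq_coef_add_kerMapA (φ' φ'' : B →ₐ[A] R) (hφ : π.comp φ'' = π.comp φ') (V : X.Opens)
    (x : Sections f V ⊗[A] B) :
    coef f φ'' V x = coef f φ' V x + kerMapA f e V (fun ℓ => tD f V (liftDiffCoord H φ' φ'' hφ ℓ) x) := by
  induction x using TensorProduct.induction_on with
  | zero =>
    simp only [map_zero]
    rw [show (fun _ : Fin d => (0 : Sections f V)) = 0 from rfl, kerMapA_zero, add_zero]
  | tmul s b =>
    simp only [coef_tmul, tD_tmul]
    rw [kerMapA_def]
    have : (fun ℓ => (liftDiffCoord H φ' φ'' hφ ℓ b • s) ⊗ₜ[A] (1 : A)) =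
        fun ℓ => s ⊗ₜ[A] (liftDiffCoord H φ' φ'' hφ ℓ b) := by
      funext ℓ
      rw [TensorProduct.smul_tmul, smul_eq_mul, mul_one]
    rw [this, kerMap_tmul_pi, liftDiffCoord_spec, ← TensorProduct.tmul_add, add_sub_cancel]
  | add x y hx hy =>
    rw [map_add, map_add, hx, hy]
    have : (fun ℓ => tD f V (liftDiffCoord H φ' φ'' hφ ℓ) (x + y)) =
        (fun ℓ => tD f V (liftDiffCoord H φ' φ'' hφ ℓ) x) + fun ℓ => tD f V (liftDiffCoord H φ' φ'' hφ ℓ) y := by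
      funext ℓ; simp
    rw [this, kerMapA_add]; abel

omit H in
/-- Two lifts of the same point give cocycles with the same reduction. [cite: GortzWedhorn2023, Prop. 27.122 (proof)] -/
theorem sameRed_map_map (p : UCocycle f U B) (φ' φ'' : B →ₐ[A] R) (hφ : π.comp φ'' = π.comp φ') :
    SameRed (p.map φ') (p.map φ'') π := fun i j => by
  simp only [UCocycle.map_val, ← coef_comp, hφ]

variable [∀ V : X.Opens, Module.Flat A (Sections f V)]

/-- **MAIN IDENTITY: the difference cochain of `p.map φ'` and `p.map φ''` is the Kodaira–Spencer cochain of the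
coordinates of `φ'' − φ'`.** [cite: GortzWedhorn2023, Prop. 27.122 (proof)] -/
theorem diffCochain_map_map (p : UCocycle f U B) (φ' φ'' : B →ₐ[A] R) (hφ : π.comp φ'' = π.comp φ') :
    diffCochain H (p.map φ') (p.map φ'') (sameRed_map_map p φ' φ'' hφ) =
      fun ℓ => ksCochain p (ρ.comp φ') (liftDiffCoord H φ' φ'' hφ ℓ) := by
  refine (diffCochain_eq_iff H _ _ _ _).2 fun i j => ?_
  simp only [UCocycle.map_val]
  rw [mul_add, mul_one, mul_kerMapA H, coef_eq_coef_add_kerMapA H φ' φ'' hφ]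
  congr 2; funext ℓ
  rw [red_coef, red_mul_ksCochain]

include hρ in
/-- **The KS cochain of a lift difference is a cocycle** (as a difference cochain). [cite: GortzWedhorn2023, Prop. 27.122 (proof)] -/
theorem ksCochain_liftDiffCoord_mem_cechZ1 (p : UCocycle f U B) (φ' φ'' : B →ₐ[A] R)
    (hφ : π.comp φ'' = π.comp φ') (ℓ : Fin d) :
    ksCochain p (ρ.comp φ') (liftDiffCoord H φ' φ'' hφ ℓ) ∈ cechZ1 f U := by
  have := diffCochain_mem_cechZ1 H hρ (p.map φ') (p.map φ'') (sameRed_map_map p φ' φ'' hφ) ℓ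
  rw [diffCochain_map_map H] at this
  exact this

include hρ in
/-- **The difference CLASS of two lifts is the KS class.** [cite: GortzWedhorn2023, Prop. 27.122 (proof)] -/
theorem diffClass_map_map (p : UCocycle f U B) (φ' φ'' : B →ₐ[A] R) (hφ : π.comp φ'' = π.comp φ') (ℓ : Fin d) :
    diffClass H hρ (p.map φ') (p.map φ'') (sameRed_map_map p φ' φ'' hφ) ℓ =
      CechH1.mk f U ⟨ksCochain p (ρ.comp φ') (liftDiffCoord H φ' φ'' hφ ℓ),
        ksCochain_liftDiffCoord_mem_cechZ1 H hρ p φ' φ'' hφ ℓ⟩ := by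
  simp only [diffClass]
  congr 1; apply Subtype.ext
  change diffCochain H (p.map φ') (p.map φ'') (sameRed_map_map p φ' φ'' hφ) ℓ = _
  rw [diffCochain_map_map H p φ' φ'' hφ]

end KS

end CechUnitCocycle

end Literature.AlgebraicGeometry.Morphisms

end
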